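import Summits.NavierStokesRegularity.FluidComputer.PalasekTowerMatchedGerm
import Summits.NavierStokesRegularity.FluidComputer.PalasekTowerHostProfiles
import Literature.Analysis.FluidPDE.CalderonSplittingLp

/-!
# The germ host, I: time profiles along the NS-acceleration line and the GLOBAL ANCHOR from the strict first-order test

Cell `ns-blowup`, seat `ns-blowup-ecbridge-3` (g3); GROUP C «BRIDGE SUPPORT» of the route
`PalasekTowerBreakdown` (crux `EpisodeBaseG`, item stmt-NavierStokesRegularity-19179, R2 of record: the
live content is `HostPreparationD (HostClass.exact S*)` ∧ `FirstEpisodeD (HostClass.exact S*)` for a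
NAMED design `S*`). LABEL: E–C typing (KERNEL: three explicit scalar profiles + one compactness
lemma). WHAT THIS IS NOT: not Navier–Stokes evidence — no stage, schedule or tower is built here and
nothing is asserted about any flow's dynamics.

## What and why

The matched germ of a compactly supported profile `U` (`PalasekTowerMatchedGerm`, p438782) is
`germ t = α(t) • U + β(t) • V`, `V = P(νΔU − (U·∇)U)` the NS acceleration of `U`. A registered
level-`0` host must satisfy the GLOBAL ANCHOR `‖u(t, x)‖ < c₁Y₀` for ALL `t < τ₀` and all `x`
(`Schedule.AnchorGlobal`), with `‖u(τ₀, x₀)‖ = c₁Y₀` at the readout. This file runs the germ ALONG THE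
LINE through `U` in the direction `V`:

  `u(t) = αhost(t) • (U + σline σ₀ (t) • V)`,  i.e. `α = αhost`, `β = βhost σ₀ = αhost · σline σ₀`,

with `αhost = ramp(2t)` (`0` before `0`, `1` from `t = 1/2` on) and
`σline σ₀ t = σ₀ (exp((t−1)/σ₀) − 1)` (`< 0` before `1`, `> −σ₀` always, `= 0` with slope `1` at
`t = 1`), so that the matching conditions `α(1) = 1, α'(1) = 0, β(1) = 0, β'(1) = 1` of
`germResid_eq_zero_of_matched` hold (§1), and proves (§2) the LINE ANCHOR from the STRICT FIRST-ORDER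
ANCHOR TEST: if `‖U‖ ≤ Y` everywhere and `⟪U(x), V(x)⟫ > 0` at every point where `‖U(x)‖ = Y`, then for
some `σ₀ > 0` every point of the segment `U + σV`, `−σ₀ < σ < 0`, has sup-norm `< Y`
(`exists_line_anchor`: `‖U + σV‖² = ‖U‖² + 2σ⟪U,V⟫ + σ²‖V‖²`, a compactness argument on `tsupport U`
with `V` bounded by `exists_norm_gradient_divPotential_le`), hence `‖germ t‖ < Y` for `t < 1`
(`norm_germ_lt`). The test says: at the speed maximum the PRESSURE-DRIVEN acceleration beats the
viscous deceleration, `−⟪U, ∇p⟫ > −ν⟪U, ΔU⟫ (≥ ν|DU|²)`; in the `≥` form it is NECESSARY for any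
anchored stage with `f(τ₀) = 0` (`Stage.anchor_inequality`, p417307). Steady Euler profiles and
viscous-dominated profiles fail it (cell STATUS K-NOTE 2026-08-26 l.3225).

References: A. J. Majda, A. L. Bertozzi, *Vorticity and Incompressible Flow* (CUP 2002), §1.8
Prop. 1.16 (Leray–Helmholtz projection) [cite: MajdaBertozziCUP2002, §1.8 Prop. 1.16];
S. Palasek, arXiv:2605.13827 §3.3 (the host push before the first readout) [cite: Palasek2026ElementaryModel, §3.3].
-/

noncomputable section

namespace Summit.NavierStokesRegularity.FluidComputer.PalasekTowerClayBridge.Germ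

open Set Function Filter Topology InnerProductSpace
open scoped Topology ContDiff RealInnerProductSpace

open Literature.Analysis.FluidPDE

/-! ## §1 The time profiles -/

/-- **The line parameter** `σline σ₀ t = σ₀ (exp((t − 1)/σ₀) − 1)`: negative before `t = 1`, never
below `−σ₀`, zero with slope one at `t = 1`. [folklore] -/
def σline (σ₀ t : ℝ) : ℝ := σ₀ * (Real.exp ((t - 1) / σ₀) - 1)

/-- **The amplitude ramp** `αhost t = ramp (2t)`: `0` before `0`, `1` from `t = 1/2` on. [folklore] -/
def αhost (t : ℝ) : ℝ := Host.ramp (2 * t)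

/-- **The acceleration coefficient** `βhost σ₀ = αhost · σline σ₀`. [folklore] -/
def βhost (σ₀ t : ℝ) : ℝ := αhost t * σline σ₀ t

section Profiles

variable {σ₀ : ℝ}

/-- `σline` is smooth. [folklore] -/
theorem contDiff_σline (σ₀ : ℝ) : ContDiff ℝ ∞ (σline σ₀) :=
  contDiff_const.mul ((Real.contDiff_exp.comp ((contDiff_id.sub contDiff_const).div_const σ₀)).sub
    contDiff_const)

/-- `σline σ₀ 1 = 0`. [folklore] -/
theorem σline_one (σ₀ : ℝ) : σline σ₀ 1 = 0 := by simp [σline]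

/-- The derivative of `σline`: `exp((t − 1)/σ₀)` (`σ₀ ≠ 0`). [folklore] -/
theorem hasDerivAt_σline (hσ₀ : σ₀ ≠ 0) (t : ℝ) :
    HasDerivAt (σline σ₀) (Real.exp ((t - 1) / σ₀)) t := by
  have h1 : HasDerivAt (fun s : ℝ => (s - 1) / σ₀) (1 / σ₀) t := by
    simpa using ((hasDerivAt_id t).sub_const 1).div_const σ₀
  have h2 := ((h1.exp).sub_const 1).const_mul σ₀
  have e : σ₀ * (Real.exp ((t - 1) / σ₀) * (1 / σ₀)) = Real.exp ((t - 1) / σ₀) := by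
    field_simp
  rw [e] at h2
  exact h2

/-- `deriv (σline σ₀) 1 = 1` (`σ₀ ≠ 0`). [folklore] -/
theorem deriv_σline_one (hσ₀ : σ₀ ≠ 0) : deriv (σline σ₀) 1 = 1 := by
  rw [(hasDerivAt_σline hσ₀ 1).deriv]
  simp

/-- Before `t = 1` the line parameter is negative (`σ₀ > 0`). [folklore] -/
theorem σline_neg (hσ₀ : 0 < σ₀) {t : ℝ} (ht : t < 1) : σline σ₀ t < 0 := by
  have h : Real.exp ((t - 1) / σ₀) < 1 := by
    rw [Real.exp_lt_one_iff]
    exact div_neg_of_neg_of_pos (by linarith) hσ₀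
  have : σ₀ * (Real.exp ((t - 1) / σ₀) - 1) < 0 := mul_neg_of_pos_of_neg hσ₀ (by linarith)
  simpa [σline] using this

/-- Up to `t = 1` the line parameter is nonpositive (`σ₀ > 0`). [folklore] -/
theorem σline_nonpos (hσ₀ : 0 < σ₀) {t : ℝ} (ht : t ≤ 1) : σline σ₀ t ≤ 0 := by
  rcases ht.lt_or_eq with h | h
  · exact (σline_neg hσ₀ h).le
  · rw [h, σline_one]

/-- The line parameter never goes below `−σ₀` (`σ₀ > 0`). [folklore] -/
theorem neg_lt_σline (hσ₀ : 0 < σ₀) (t : ℝ) : -σ₀ < σline σ₀ t := by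
  have h : 0 < Real.exp ((t - 1) / σ₀) := Real.exp_pos _
  have : -σ₀ < σ₀ * (Real.exp ((t - 1) / σ₀) - 1) := by nlinarith
  simpa [σline] using this

/-- `|σline σ₀ t| ≤ σ₀` for `t ≤ 1` (`σ₀ > 0`). [folklore] -/
theorem abs_σline_le (hσ₀ : 0 < σ₀) {t : ℝ} (ht : t ≤ 1) : |σline σ₀ t| ≤ σ₀ := by
  rw [abs_le]
  exact ⟨(neg_lt_σline hσ₀ t).le, (σline_nonpos hσ₀ ht).trans hσ₀.le⟩

/-- `αhost` is smooth. [folklore] -/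
theorem contDiff_αhost : ContDiff ℝ ∞ αhost :=
  Host.contDiff_ramp.comp (contDiff_const.mul contDiff_id)

/-- `αhost t = 0` for `t ≤ 0`. [folklore] -/
theorem αhost_of_nonpos {t : ℝ} (ht : t ≤ 0) : αhost t = 0 :=
  Host.ramp_of_nonpos (by linarith)

/-- `αhost t = 1` for `t ≥ 1/2`. [folklore] -/
theorem αhost_of_half_le {t : ℝ} (ht : 1 / 2 ≤ t) : αhost t = 1 :=
  Host.ramp_of_one_le (by linarith)

/-- `αhost 1 = 1`. [folklore] -/
theorem αhost_one : αhost 1 = 1 := αhost_of_half_le (by norm_num)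

/-- `0 ≤ αhost`. [folklore] -/
theorem αhost_nonneg (t : ℝ) : 0 ≤ αhost t := Host.ramp_nonneg _

/-- `αhost ≤ 1`. [folklore] -/
theorem αhost_le_one (t : ℝ) : αhost t ≤ 1 := Host.ramp_le_one _

/-- `|αhost| ≤ 1`. [folklore] -/
theorem abs_αhost_le_one (t : ℝ) : |αhost t| ≤ 1 := by
  rw [abs_of_nonneg (αhost_nonneg t)]
  exact αhost_le_one t

/-- `deriv αhost 1 = 0` (`αhost` is constant near `t = 1`). [folklore] -/
theorem deriv_αhost_one : deriv αhost 1 = 0 := by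
  have hev : αhost =ᶠ[𝓝 (1 : ℝ)] fun _ => (1 : ℝ) := by
    filter_upwards [lt_mem_nhds (show (1 : ℝ) / 2 < 1 by norm_num)] with s hs
    exact αhost_of_half_le hs.le
  rw [hev.deriv_eq, deriv_const]

/-- `βhost` is smooth. [folklore] -/
theorem contDiff_βhost (σ₀ : ℝ) : ContDiff ℝ ∞ (βhost σ₀) :=
  contDiff_αhost.mul (contDiff_σline σ₀)

/-- `βhost σ₀ t = 0` for `t ≤ 0`. [folklore] -/
theorem βhost_of_nonpos {t : ℝ} (ht : t ≤ 0) : βhost σ₀ t = 0 := by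
  rw [βhost, αhost_of_nonpos ht, zero_mul]

/-- `βhost σ₀ 1 = 0`. [folklore] -/
theorem βhost_one (σ₀ : ℝ) : βhost σ₀ 1 = 0 := by
  rw [βhost, σline_one, mul_zero]

/-- `deriv (βhost σ₀) 1 = 1` (`σ₀ ≠ 0`): `α'(1) σ(1) + α(1) σ'(1) = 0 + 1`. [folklore] -/
theorem deriv_βhost_one (hσ₀ : σ₀ ≠ 0) : deriv (βhost σ₀) 1 = 1 := by
  have hα : DifferentiableAt ℝ αhost 1 := (contDiff_αhost.differentiable (by simp)) 1
  have hσ : DifferentiableAt ℝ (σline σ₀) 1 := (hasDerivAt_σline hσ₀ 1).differentiableAt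
  have e : βhost σ₀ = fun t => αhost t * σline σ₀ t := rfl
  rw [e, deriv_fun_mul hα hσ, deriv_αhost_one, deriv_σline_one hσ₀, αhost_one, σline_one]
  ring

/-- `|βhost σ₀ t| ≤ σ₀` for `t ≤ 1` (`σ₀ > 0`). [folklore] -/
theorem abs_βhost_le (hσ₀ : 0 < σ₀) {t : ℝ} (ht : t ≤ 1) : |βhost σ₀ t| ≤ σ₀ := by
  rw [βhost, abs_mul]
  calc |αhost t| * |σline σ₀ t| ≤ 1 * σ₀ :=
        mul_le_mul (abs_αhost_le_one t) (abs_σline_le hσ₀ ht) (abs_nonneg _) zero_le_one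
    _ = σ₀ := one_mul _

/-- **The germ with these profiles runs along the line**:
`germ t = αhost t • (U + σline σ₀ t • V)`. [folklore] -/
theorem germ_eq_smul_line (ν : ℝ) (U : EuclideanSpace ℝ (Fin 3) → EuclideanSpace ℝ (Fin 3))
    (σ₀ t : ℝ) (x : EuclideanSpace ℝ (Fin 3)) :
    germ ν U αhost (βhost σ₀) t x = αhost t • (U x + σline σ₀ t • accel ν U x) := by
  rw [germ, βhost, smul_add, smul_smul]

/-- With these profiles the germ starts from rest: `germ 0 = 0`. [folklore] -/
theorem germ_line_zero (ν : ℝ) (U : EuclideanSpace ℝ (Fin 3) → EuclideanSpace ℝ (Fin 3)) (σ₀ : ℝ) :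
    germ ν U αhost (βhost σ₀) 0 = 0 :=
  germ_zero (αhost_of_nonpos le_rfl) (βhost_of_nonpos le_rfl)

/-- With these profiles the germ passes through the profile at `t = 1`: `germ 1 = U`. [folklore] -/
theorem germ_line_one (ν : ℝ) (U : EuclideanSpace ℝ (Fin 3) → EuclideanSpace ℝ (Fin 3)) (σ₀ : ℝ) :
    germ ν U αhost (βhost σ₀) 1 = U := by
  funext x
  rw [germ, αhost_one, βhost_one, one_smul, zero_smul, add_zero]

end Profiles

/-! ## §2 The line anchor from the strict first-order test -/

section Anchor

variable {ν : ℝ} {U : EuclideanSpace ℝ (Fin 3) → EuclideanSpace ℝ (Fin 3)}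

/-- **The NS acceleration of a test profile is bounded** (`V = W − ∇π[W]`: the drift `W` is continuous
with compact support and `∇π[W]` is bounded, `CalderonSplittingLp.exists_norm_gradient_divPotential_le`).
[folklore] -/
theorem exists_norm_accel_le (hU : ContDiff ℝ ∞ U) (hUc : HasCompactSupport U) (ν : ℝ) :
    ∃ M : ℝ, 0 ≤ M ∧ ∀ x, ‖accel ν U x‖ ≤ M := by
  obtain ⟨C, hC⟩ := (contDiff_drift hU ν).continuous.bounded_above_of_compact_support
    (hasCompactSupport_drift hUc ν)
  obtain ⟨K, hK⟩ := CalderonSplittingLp.exists_norm_gradient_divPotential_le (contDiff_drift hU ν)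
    (hasCompactSupport_drift hUc ν)
  refine ⟨max (C + K) 0, le_max_right _ _, fun x => ?_⟩
  rw [accel_apply ν x]
  calc ‖drift ν U x - gradient (pot ν U) x‖ ≤ ‖drift ν U x‖ + ‖gradient (pot ν U) x‖ :=
        norm_sub_le _ _
    _ ≤ C + K := add_le_add (hC x) (hK x)
    _ ≤ max (C + K) 0 := le_max_left _ _

/-- The square of the norm on the line: `‖U + σV‖² = ‖U‖² + 2σ⟪U, V⟫ + σ²‖V‖²`. [folklore] -/
theorem norm_add_smul_sq (a b : EuclideanSpace ℝ (Fin 3)) (σ : ℝ) :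
    ‖a + σ • b‖ ^ 2 = ‖a‖ ^ 2 + 2 * σ * ⟪a, b⟫ + σ ^ 2 * ‖b‖ ^ 2 := by
  rw [norm_add_sq_real, real_inner_smul_right, norm_smul, Real.norm_eq_abs, mul_pow, sq_abs]
  ring

/-- **THE LINE ANCHOR FROM THE STRICT FIRST-ORDER TEST.** Let `U` be smooth with compact support,
`‖U‖ ≤ Y` everywhere (`Y > 0`), and suppose `⟪U(x), V(x)⟫ > 0` at every point where `‖U(x)‖ = Y`
(`V = P(νΔU − (U·∇)U)`). Then for some `σ₀ > 0` every point of the segment `{U + σV : −σ₀ < σ < 0}`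
has sup-norm `< Y`. Proof: `V` is bounded by `M`; off the open set `{⟪U,V⟫ > 0}` the compact support
carries `‖U‖ ≤ Y − δ`; on the compact set `{‖U‖ ≥ Y − δ/2}` one has `⟪U,V⟫ ≥ 2κ > 0`; then
`‖U + σV‖² ≤ Y² + σ(4κ + σM²) < Y²` near the maximum and `‖U + σV‖ ≤ Y − δ/2 + |σ|M < Y` away from
it. [cite: MajdaBertozziCUP2002, §1.8 Prop. 1.16] -/
theorem exists_line_anchor (hU : ContDiff ℝ ∞ U) (hUc : HasCompactSupport U) {Y : ℝ} (hY : 0 < Y)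
    (hle : ∀ x, ‖U x‖ ≤ Y) (htest : ∀ x, ‖U x‖ = Y → 0 < ⟪U x, accel ν U x⟫) :
    ∃ σ₀ : ℝ, 0 < σ₀ ∧ ∀ σ : ℝ, -σ₀ < σ → σ < 0 → ∀ x, ‖U x + σ • accel ν U x‖ < Y := by
  set V := accel ν U with hV
  set g : EuclideanSpace ℝ (Fin 3) → ℝ := fun x => ⟪U x, V x⟫ with hg
  have hUcont : Continuous U := hU.continuous
  have hVcont : Continuous V := (contDiff_accel hU hUc ν).continuous
  have hgc : Continuous g := hUcont.inner hVcont
  have hnc : Continuous fun x => ‖U x‖ := hUcont.norm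
  obtain ⟨M, hM0, hM⟩ := exists_norm_accel_le hU hUc ν
  -- the compact support
  set K := tsupport U with hK
  have hKc : IsCompact K := hUc
  -- step 1: off `{g > 0}` the support carries `‖U‖ ≤ Y − δ`
  set K₁ := K ∩ {x | g x ≤ 0} with hK₁
  have hK₁c : IsCompact K₁ := hKc.inter_right (isClosed_le hgc continuous_const)
  have hlt₁ : ∀ x ∈ K₁, -Y < -‖U x‖ := by
    intro x hx
    have hne : ‖U x‖ ≠ Y := fun h => absurd (htest x h) (not_lt.2 hx.2)
    have := lt_of_le_of_ne (hle x) hne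
    linarith
  obtain ⟨a₁, ha₁, ha₁'⟩ := hK₁c.exists_forall_le' (f := fun x => -‖U x‖) hnc.neg.continuousOn hlt₁
  -- `δ := min (Y + a₁) Y ∈ (0, Y]`, and `‖U‖ ≤ Y − δ` on `K₁`
  set δ := min (Y + a₁) Y with hδ
  have hδ0 : 0 < δ := lt_min (by linarith) hY
  have hδY : δ ≤ Y := min_le_right _ _
  have hK₁U : ∀ x ∈ K₁, ‖U x‖ ≤ Y - δ := by
    intro x hx
    have := ha₁' x hx
    have : δ ≤ Y + a₁ := min_le_left _ _
    linarith
  -- step 2: on the compact set `{‖U‖ ≥ Y − δ/2}` the test function is `≥ 2κ > 0`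
  set M₂ := K ∩ {x | Y - δ / 2 ≤ ‖U x‖} with hM₂
  have hM₂c : IsCompact M₂ := hKc.inter_right (isClosed_le continuous_const hnc)
  have hpos₂ : ∀ x ∈ M₂, 0 < g x := by
    intro x hx
    by_contra h
    have hx1 : x ∈ K₁ := ⟨hx.1, not_lt.1 h⟩
    have h1 : ‖U x‖ ≤ Y - δ := hK₁U x hx1
    have h2 : Y - δ / 2 ≤ ‖U x‖ := hx.2
    linarith
  obtain ⟨κ2, hκ2, hκ2'⟩ := hM₂c.exists_forall_le' (f := g) hgc.continuousOn hpos₂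
  -- the width of the segment
  set σ₀ := min (κ2 / (M ^ 2 + 1)) (δ / (2 * (M + 1))) with hσ₀
  have hσ₀0 : 0 < σ₀ := lt_min (by positivity) (by positivity)
  refine ⟨σ₀, hσ₀0, fun σ hσl hσu x => ?_⟩
  have hσabs : |σ| < σ₀ := by rw [abs_lt]; exact ⟨hσl, by linarith⟩
  have hσ1 : |σ| < κ2 / (M ^ 2 + 1) := lt_of_lt_of_le hσabs (min_le_left _ _)
  have hσ2 : |σ| < δ / (2 * (M + 1)) := lt_of_lt_of_le hσabs (min_le_right _ _)
  have hσabs' : |σ| = -σ := abs_of_neg hσu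
  by_cases hnear : Y - δ / 2 ≤ ‖U x‖
  · -- near the maximum: `x ∈ M₂` (it lies in the support since `‖U x‖ > 0`)
    have hxK : x ∈ K := by
      have hUx : U x ≠ 0 := by
        intro h0
        rw [h0, norm_zero] at hnear
        linarith
      exact subset_tsupport _ (mem_support.2 hUx)
    have hgx : κ2 ≤ g x := hκ2' x ⟨hxK, hnear⟩
    have hVx : ‖V x‖ ≤ M := hM x
    have hsq : ‖U x + σ • V x‖ ^ 2 < Y ^ 2 := by
      rw [norm_add_smul_sq]
      have h1 : ‖U x‖ ^ 2 ≤ Y ^ 2 := pow_le_pow_left₀ (norm_nonneg _) (hle x) 2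
      have h2 : 2 * σ * ⟪U x, V x⟫ ≤ 2 * σ * κ2 := by
        have : σ * g x ≤ σ * κ2 := mul_le_mul_of_nonpos_left hgx hσu.le
        simp only [hg] at this
        linarith
      have h3 : σ ^ 2 * ‖V x‖ ^ 2 ≤ σ ^ 2 * M ^ 2 :=
        mul_le_mul_of_nonneg_left (pow_le_pow_left₀ (norm_nonneg _) hVx 2) (sq_nonneg _)
      -- `σ (2κ2 + σ M²) < 0` since `|σ| (M² + 1) < κ2`
      have h4 : -σ * (M ^ 2 + 1) < κ2 := by
        rw [← hσabs']
        rwa [lt_div_iff₀ (by positivity)] at hσ1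
      nlinarith [sq_nonneg σ, sq_nonneg M]
    exact lt_of_pow_lt_pow_left₀ 2 hY.le hsq
  · -- away from the maximum
    rw [not_le] at hnear
    have hVx : ‖V x‖ ≤ M := hM x
    have h4 : -σ * (2 * (M + 1)) < δ := by
      rw [← hσabs']
      rwa [lt_div_iff₀ (by positivity)] at hσ2
    calc ‖U x + σ • V x‖ ≤ ‖U x‖ + ‖σ • V x‖ := norm_add_le _ _
      _ = ‖U x‖ + -σ * ‖V x‖ := by rw [norm_smul, Real.norm_eq_abs, hσabs']
      _ ≤ ‖U x‖ + -σ * M := by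
          have : -σ * ‖V x‖ ≤ -σ * M := mul_le_mul_of_nonneg_left hVx (by linarith)
          linarith
      _ < Y := by nlinarith

/-- **THE GLOBAL ANCHOR OF THE GERM ALONG THE LINE**: under the line anchor at width `σ₀`, the germ
with the profiles `αhost`, `βhost σ₀` has sup-norm `< Y` at every time `t < 1`
(`germ t = αhost t • (U + σline σ₀ t • V)` with `0 ≤ αhost ≤ 1` and `−σ₀ < σline σ₀ t < 0`). [folklore] -/
theorem norm_germ_lt {Y σ₀ : ℝ} (hσ₀ : 0 < σ₀)
    (hline : ∀ σ : ℝ, -σ₀ < σ → σ < 0 → ∀ x, ‖U x + σ • accel ν U x‖ < Y)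
    {t : ℝ} (ht : t < 1) (x : EuclideanSpace ℝ (Fin 3)) :
    ‖germ ν U αhost (βhost σ₀) t x‖ < Y := by
  rw [germ_eq_smul_line, norm_smul, Real.norm_eq_abs, abs_of_nonneg (αhost_nonneg t)]
  have h := hline (σline σ₀ t) (neg_lt_σline hσ₀ t) (σline_neg hσ₀ ht) x
  calc αhost t * ‖U x + σline σ₀ t • accel ν U x‖
      ≤ 1 * ‖U x + σline σ₀ t • accel ν U x‖ :=
        mul_le_mul_of_nonneg_right (αhost_le_one t) (norm_nonneg _)
    _ < Y := by rw [one_mul]; exact h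

/-- … and `≤ Y` up to and including `t = 1` (where `germ 1 = U`). [folklore] -/
theorem norm_germ_le {Y σ₀ : ℝ} (hσ₀ : 0 < σ₀) (hle : ∀ x, ‖U x‖ ≤ Y)
    (hline : ∀ σ : ℝ, -σ₀ < σ → σ < 0 → ∀ x, ‖U x + σ • accel ν U x‖ < Y)
    {t : ℝ} (ht : t ≤ 1) (x : EuclideanSpace ℝ (Fin 3)) :
    ‖germ ν U αhost (βhost σ₀) t x‖ ≤ Y := by
  rcases ht.lt_or_eq with h | h
  · exact (norm_germ_lt hσ₀ hline h x).le
  · rw [h, germ_line_one]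
    exact hle x

end Anchor

end Summit.NavierStokesRegularity.FluidComputer.PalasekTowerClayBridge.Germ

end
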